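import Summits.ABC.IUTFork.Repair.ObstructionSS28Budget
import HarnessLib

/-!
# IUT REPAIR branch → R-H (D-0079), abc-iut-rp-s2 lineage — `ObstructionSS28WindowExplicit`: the EXPLICIT SUFFICIENT window door for an ARBITRARY
# (e.g. ADAPTIVE, place-dependent) window `W` — k2 door of R-H ROUND 1 row 13 «adaptive-label-cut» (plan/rescue/R-H/RH-CANDIDATES.tsv v1.1)

PROOF-ONLY satellite (own namespace `Summit.ABC.IUTFork.Repair.ObstructionSS28WindowExplicit`; D-0012: 0 definitions, 0 `Prop` facts; abc-iut cell,
rung LADDER-ABC:A2.RP → A2.RESCUE-H; seat abc-iut-rp-s2 gen 4, ONE-WRITER lane «per-cell slack ledger σ + budget identities», k2 desk hand of rows 11/13).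
TAKES NO SIDE on [IUTchIII] Cor. 3.12 or on any author; candidate readings are bound hypotheses; typed ≠ proved; DEFS-FREEZE respected; inputs ⊆ the
frozen FACT-LIST; standard axioms. `σ := logvol(ⁿ˒°𝒰) − qLocal`, `floor := ((i+1)² − 1)·(−qLocal)` per cell (spelled out, never defined).

WHY. For a window candidate the Statement-level budget «off-window deficit ≤ on-window surplus» IS the typed Corollary
(`ObstructionSS28Window.statement_iff_budget_of_starOn`), so «I06⋆ on W ∧ budget» restates the Statement (k4). What does NOT restate it is the
EXPLICIT sufficient inequality in table currency: a LOWER container-volume law `δ⁻` on the window cells (the `slack_minus` column there) against the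
FLOOR MASS off the window (`ObstructionSS28Budget.cellSlack_ge_neg_floor_at`: a cell's deficit never exceeds its floor). `ObstructionSS28LabelCut`
§8b did this for the UNIFORM cut `j ≤ j₀`; here `W ⊆ 𝔽_l^⋇ × V_ℚ` is arbitrary, so the ADAPTIVE cut `W(w) = {j ≤ j₀(w)}` of row 13 is covered.
* `finsum_on_lowerIndex_sub_floor_le` — on-window, label by label: `Σᶠ_{v ∈ W_i} (δ⁻ − floor) ≤ Σᶠ_{v ∈ W_i} σ` (containers reading + lower law on `W`);
* **`statement_of_lowerIndexOn_ge_floorMassOff`** — bridge hypotheses, (ii)(b), Θ-pin; hull = log-shell orbit and `(i+1)²·qLocal + δ⁻ ≤ logvol(orbit)`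
  on the cells of `W`; honest `j²`-scaling off `W`; and `PN Σᶠ_{∉W} floor ≤ PN Σᶠ_{W} (δ⁻ − floor)` ⟹ the typed Statement. No I06⋆, nothing about the
  hull off `W`; NOT equivalent to the Statement.
HONEST SCOPE. Pure bookkeeping over the frozen vocabulary; nothing decides a genuine cell; `δ⁻` is an inline binder. [claim: Mochizuki2012, status: disputed]
[cite: ScholzeStix2018, §2.2 p. 10 l. 26–30]. Axioms: standard.
-/

noncomputable section

open Set

namespace Summit.ABC.IUTFork.Repair.ObstructionSS28WindowExplicit

open Thm311 Cor312 Cor312Vol Literature.IUT.LogThetaLattice Summit.ABC.IUTFork.Repair.CandInternal2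
  Summit.ABC.IUTFork.Repair.CandInternal11Gap Summit.ABC.IUTFork.Repair.CandInternal11GapWindow
  Summit.ABC.IUTFork.Repair.ObstructionSS28Window Summit.ABC.IUTFork.Repair.ObstructionSS28Budget

variable {T : ThetaIndex} (S : LatticeSituation T) (P : Cor312.Setting S.toSituation)
  (ρ : (∀ v : T.V, v ∈ T.Vbad → Set (S.L.StarPacket v)) → ∀ (j : T.Label) (vQ : T.VQ), Set (S.L.Packet j vQ))
  (W : Set (Fin T.lstar × T.VQ)) (δlo : Fin T.lstar → T.VQ → ℝ)

/-- **On the window, label by label, the guaranteed surplus bounds the surplus from below**: in the containers reading on the cells of `W` at label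
`i+1` (hull = log-shell orbit; lower container-volume law `(i+1)²·qLocal + δ⁻ ≤ logvol(orbit)`, `δ⁻` finitely supported), `Σᶠ_{v : (i,v) ∈ W} (δ⁻ − floor) ≤
Σᶠ_{v : (i,v) ∈ W} σ` (`ThetaFinite` for the supports). [claim: Mochizuki2012, status: disputed] -/
theorem finsum_on_lowerIndex_sub_floor_le (hfin : P.ThetaFinite) (i : Fin T.lstar) (hδ : (Function.support (δlo i)).Finite)
    (hhull : ∀ vQ : T.VQ, (i, vQ) ∈ W →
      P.thetaHull (Setting.labelSucc i) vQ = ⋃ m : ℤ, ρ (shellSat S P.n ((S.col P.n).frobΨ m)) (Setting.labelSucc i) vQ)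
    (hcont : ∀ vQ : T.VQ, (i, vQ) ∈ W →
      (((i : ℕ) + 1 : ℕ) : ℝ) ^ 2 * P.qLocal (Setting.labelSucc i) vQ + δlo i vQ ≤
        (S.D P.n).logvol _ vQ (⋃ m : ℤ, ρ (shellSat S P.n ((S.col P.n).frobΨ m)) (Setting.labelSucc i) vQ)) :
    ∑ᶠ vQ ∈ {vQ : T.VQ | (i, vQ) ∈ W}, (δlo i vQ - ((((i : ℕ) + 1 : ℕ) : ℝ) ^ 2 - 1) * (-P.qLocal (Setting.labelSucc i) vQ)) ≤
      ∑ᶠ vQ ∈ {vQ : T.VQ | (i, vQ) ∈ W},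
        ((S.D P.n).logvol _ vQ (P.thetaHull (Setting.labelSucc i) vQ) - P.qLocal (Setting.labelSucc i) vQ) := by
  have hf : (Function.support ({vQ : T.VQ | (i, vQ) ∈ W}.indicator fun vQ : T.VQ =>
      δlo i vQ - ((((i : ℕ) + 1 : ℕ) : ℝ) ^ 2 - 1) * (-P.qLocal (Setting.labelSucc i) vQ))).Finite := by
    rw [Set.support_indicator]
    refine ((hδ.union (floor_support_finite S P i)).subset fun vQ hvQ => ?_).inter_of_right _
    by_contra hn
    simp only [Set.mem_union, Function.mem_support, not_or, not_not] at hn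
    exact hvQ (by simp only [hn.1, hn.2, sub_zero])
  have hg : (Function.support ({vQ : T.VQ | (i, vQ) ∈ W}.indicator fun vQ : T.VQ =>
      (S.D P.n).logvol _ vQ (P.thetaHull (Setting.labelSucc i) vQ) - P.qLocal (Setting.labelSucc i) vQ)).Finite := by
    rw [Set.support_indicator]
    exact (cellSlack_support_finite S P hfin i).inter_of_right _
  rw [finsum_mem_def, finsum_mem_def]
  refine finsum_le_finsum' hf hg fun vQ => ?_
  by_cases hW : (i, vQ) ∈ W
  · have hm : vQ ∈ {vQ : T.VQ | (i, vQ) ∈ W} := hW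
    simp only [Set.indicator_of_mem hm]
    have hc := hcont vQ hW
    rw [← hhull vQ hW] at hc
    linarith
  · have hn : vQ ∉ {vQ : T.VQ | (i, vQ) ∈ W} := hW
    simp only [Set.indicator_of_notMem hn, le_refl]

/-- **THE EXPLICIT SUFFICIENT WINDOW DOOR (arbitrary / adaptive window).** Under the bridge hypotheses, Thm. 3.11 (ii)(b) and the Θ-pin: the
containers reading with a finitely supported LOWER container-volume law `δ⁻` on the cells of `W` (the table's sufficient exponent there), honest
`j²`-scaling at the cells off `W`, and the EXPLICIT budget `PN(i ↦ Σᶠ_{v : (i,v) ∉ W} floor) ≤ PN(i ↦ Σᶠ_{v : (i,v) ∈ W} (δ⁻ − floor))` give the typed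
Statement — no I06⋆ hypothesis, nothing about the hull off `W` (`ObstructionSS28Budget.statement_of_cells_of_surplus_ge_floorMass` with the on-window
term bounded below). NOT equivalent to the Statement. [claim: Mochizuki2012, status: disputed] -/
theorem statement_of_lowerIndexOn_ge_floorMassOff (HB : BridgeHyps P) (hKumB : (S.col P.n).KummerB (S.D P.n)) (hΘ : ThetaPinned S P ρ)
    (hδ : ∀ i : Fin T.lstar, (Function.support (δlo i)).Finite)
    (hhull : ∀ (i : Fin T.lstar) (vQ : T.VQ), (i, vQ) ∈ W →
      P.thetaHull (Setting.labelSucc i) vQ = ⋃ m : ℤ, ρ (shellSat S P.n ((S.col P.n).frobΨ m)) (Setting.labelSucc i) vQ)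
    (hcont : ∀ (i : Fin T.lstar) (vQ : T.VQ), (i, vQ) ∈ W →
      (((i : ℕ) + 1 : ℕ) : ℝ) ^ 2 * P.qLocal (Setting.labelSucc i) vQ + δlo i vQ ≤
        (S.D P.n).logvol _ vQ (⋃ m : ℤ, ρ (shellSat S P.n ((S.col P.n).frobΨ m)) (Setting.labelSucc i) vQ))
    (hscaled_off : ∀ (i : Fin T.lstar) (vQ : T.VQ), (i, vQ) ∉ W →
      (S.D P.n).logvol _ vQ (ρ (S.D P.n).Ψ (Setting.labelSucc i) vQ) = (((i : ℕ) + 1 : ℕ) : ℝ) ^ 2 * P.qLocal (Setting.labelSucc i) vQ)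
    (hbudget : processionNormalized (fun i : Fin T.lstar => ∑ᶠ vQ ∈ {vQ : T.VQ | (i, vQ) ∉ W},
          ((((i : ℕ) + 1 : ℕ) : ℝ) ^ 2 - 1) * (-P.qLocal (Setting.labelSucc i) vQ)) ≤
      processionNormalized (fun i : Fin T.lstar => ∑ᶠ vQ ∈ {vQ : T.VQ | (i, vQ) ∈ W},
          (δlo i vQ - ((((i : ℕ) + 1 : ℕ) : ℝ) ^ 2 - 1) * (-P.qLocal (Setting.labelSucc i) vQ)))) :
    P.Statement := by
  rw [statement_iff_window_budget S P W HB.finite]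
  have h1 : processionNormalized (fun i : Fin T.lstar => ∑ᶠ vQ ∈ {vQ : T.VQ | (i, vQ) ∈ W},
          (δlo i vQ - ((((i : ℕ) + 1 : ℕ) : ℝ) ^ 2 - 1) * (-P.qLocal (Setting.labelSucc i) vQ))) ≤
      processionNormalized (fun i : Fin T.lstar => ∑ᶠ vQ ∈ {vQ : T.VQ | (i, vQ) ∈ W},
          ((S.D P.n).logvol _ vQ (P.thetaHull (Setting.labelSucc i) vQ) - P.qLocal (Setting.labelSucc i) vQ)) :=
    processionNormalized_mono fun i =>
      finsum_on_lowerIndex_sub_floor_le S P ρ W δlo HB.finite i (hδ i) (fun vQ hW => hhull i vQ hW) fun vQ hW => hcont i vQ hW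
  have h2 := offWindow_deficit_le_floorMass S P ρ W HB hKumB hΘ hscaled_off
  linarith

/-- **The ADAPTIVE LABEL CUT** (R-H ROUND 1 row 13): the window `W := {(i, v) | i+1 ≤ j₀(v)}` for a place-dependent cut `j₀ : V_ℚ → ℕ` is an
instance — the same door with the window membership spelled `i+1 ≤ j₀ v`. [claim: Mochizuki2012, status: disputed] -/
theorem statement_of_adaptiveLabelCut_explicit (j₀ : T.VQ → ℕ) (HB : BridgeHyps P) (hKumB : (S.col P.n).KummerB (S.D P.n))
    (hΘ : ThetaPinned S P ρ) (hδ : ∀ i : Fin T.lstar, (Function.support (δlo i)).Finite)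
    (hhull : ∀ (i : Fin T.lstar) (vQ : T.VQ), (i : ℕ) + 1 ≤ j₀ vQ →
      P.thetaHull (Setting.labelSucc i) vQ = ⋃ m : ℤ, ρ (shellSat S P.n ((S.col P.n).frobΨ m)) (Setting.labelSucc i) vQ)
    (hcont : ∀ (i : Fin T.lstar) (vQ : T.VQ), (i : ℕ) + 1 ≤ j₀ vQ →
      (((i : ℕ) + 1 : ℕ) : ℝ) ^ 2 * P.qLocal (Setting.labelSucc i) vQ + δlo i vQ ≤
        (S.D P.n).logvol _ vQ (⋃ m : ℤ, ρ (shellSat S P.n ((S.col P.n).frobΨ m)) (Setting.labelSucc i) vQ))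
    (hscaled_off : ∀ (i : Fin T.lstar) (vQ : T.VQ), j₀ vQ < (i : ℕ) + 1 →
      (S.D P.n).logvol _ vQ (ρ (S.D P.n).Ψ (Setting.labelSucc i) vQ) = (((i : ℕ) + 1 : ℕ) : ℝ) ^ 2 * P.qLocal (Setting.labelSucc i) vQ)
    (hbudget : processionNormalized (fun i : Fin T.lstar => ∑ᶠ vQ ∈ {vQ : T.VQ | j₀ vQ < (i : ℕ) + 1},
          ((((i : ℕ) + 1 : ℕ) : ℝ) ^ 2 - 1) * (-P.qLocal (Setting.labelSucc i) vQ)) ≤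
      processionNormalized (fun i : Fin T.lstar => ∑ᶠ vQ ∈ {vQ : T.VQ | (i : ℕ) + 1 ≤ j₀ vQ},
          (δlo i vQ - ((((i : ℕ) + 1 : ℕ) : ℝ) ^ 2 - 1) * (-P.qLocal (Setting.labelSucc i) vQ)))) :
    P.Statement := by
  refine statement_of_lowerIndexOn_ge_floorMassOff S P ρ {x : Fin T.lstar × T.VQ | (x.1 : ℕ) + 1 ≤ j₀ x.2} δlo HB hKumB hΘ hδ
    (fun i vQ hW => hhull i vQ hW) (fun i vQ hW => hcont i vQ hW) (fun i vQ hW => hscaled_off i vQ (not_le.mp hW)) ?_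
  have hon : ∀ i : Fin T.lstar, {vQ : T.VQ | (i, vQ) ∈ {x : Fin T.lstar × T.VQ | (x.1 : ℕ) + 1 ≤ j₀ x.2}} =
      {vQ : T.VQ | (i : ℕ) + 1 ≤ j₀ vQ} := fun i => rfl
  have hoff : ∀ i : Fin T.lstar, {vQ : T.VQ | (i, vQ) ∉ {x : Fin T.lstar × T.VQ | (x.1 : ℕ) + 1 ≤ j₀ x.2}} =
      {vQ : T.VQ | j₀ vQ < (i : ℕ) + 1} := fun i => by
    ext vQ
    simp only [Set.mem_setOf_eq, not_le]
  simp only [hon, hoff]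
  exact hbudget

end Summit.ABC.IUTFork.Repair.ObstructionSS28WindowExplicit

end
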